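import Summits.QuantumAdvantage.QuantumAdvantage.Theorems.CubicForrelationNearExactIsExactKtGapCubic

/-!
# Crux `CubicForrelation.NearExactIsExact` (stmt-QuantumAdvantage-14043) — the Kasami–Tokura gap of cubics for EVERY `m`: no Boolean function of
  degree `≤ 3` has weight strictly between `1.5·2^{m-3}` and `1.75·2^{m-3}`

Certificate seat `b2b-cforr-cert` (gen 16).  HONEST FRAMING: a coding-theory BRICK (standard axioms), uniform in `m` — NOT summit progress.  It upgrades
`kt_gap_cubic_le_sixteen` (`…KtGapCubic.lean`, closing arithmetic done numerically for `m ≤ 16`) by a UNIFORM closing of the Diophantine system of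
`ktg_step`:  with `D = 2·2^k`, `w = 3D + t`, Parseval gives `B·(D + 2t) = 39D + 10t − 16t²` and `t² < 4D` (`ktg_t_sq_lt`), the derivative count gives
`D ∣ t²`, so `t² ∈ {D, 2D, 3D}`; `3·2^{k+1}` is never a square; `t² = D` forces `(t + 2) ∣ 36`, i.e. `t ∈ {4, 16}` (`k = 3, 7`, the two cases where
the fourth moment is needed — `ktg_no_solution`); `t² = 2D` forces `(t + 4) ∣ 8`, impossible for `k ≥ 3`.  Statement: `kt_gap_cubic` — for every
`m` and every `c : 𝔽₂^m → 𝔽₂` of degree `≤ 3`, NOT (`3·2^m < 16·#{c = 1}` and `32·#{c = 1} < 7·2^m`).  (Kasami–Tokura 1970 obtain this from their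
classification of all words of `RM(r,m)` of weight `< 2d`; the proof here is self-contained and classification-free.)

References: T. Kasami, N. Tokura, IEEE Trans. IT 16 (1970) 752–759, Thm 1; MacWilliams–Sloane (1977) Ch. 15 §3.  Axioms: standard.
-/

set_option linter.dupNamespace false -- D-0017: single-problem summit ⇒ `QuantumAdvantage.QuantumAdvantage` by design

noncomputable section

namespace Summit.QuantumAdvantage.QuantumAdvantage.Theorems.CubicForrelation.NearExactIsExact

open Finset
open Literature.Computability.QuantumComplexity

/-! ### Arithmetic: `3·2^n` is not a square; powers of two -/

/-- `t² ≠ 3·2^n`. [folklore] -/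
theorem ktg_sq_ne_three_mul_two_pow : ∀ (n t : ℕ), t * t ≠ 3 * 2 ^ n := by
  intro n
  induction n using Nat.strong_induction_on with
  | _ n ih =>
    intro t h
    rcases Nat.lt_or_ge n 2 with hn | hn
    · interval_cases n
      · have : t ≤ 2 := by nlinarith
        interval_cases t <;> omega
      · have : t ≤ 3 := by nlinarith
        interval_cases t <;> omega
    · -- `4 ∣ t²`, so `2 ∣ t`, descend
      obtain ⟨n', rfl⟩ : ∃ n', n = n' + 2 := ⟨n - 2, by omega⟩
      have h4 : 2 ^ 2 ∣ t * t := ⟨3 * 2 ^ n', by rw [h]; ring⟩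
      have h2 : 2 ^ 1 ∣ t := by have := ktg_two_pow_dvd_of_sq (a := 2) h4; simpa using this
      obtain ⟨t', rfl⟩ : 2 ∣ t := by simpa using h2
      have h' : t' * t' = 3 * 2 ^ n' := by
        have e : 2 * t' * (2 * t') = 4 * (t' * t') := by ring
        rw [e, pow_add] at h
        omega
      exact ih n' (by omega) t' h'

/-- A square which is a power of two is an even power: `t² = 2^n ⇒ n` even and `t = 2^{n/2}`. [folklore] -/
theorem ktg_sq_eq_two_pow : ∀ (n t : ℕ), t * t = 2 ^ n → ∃ j, n = 2 * j ∧ t = 2 ^ j := by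
  intro n
  induction n using Nat.strong_induction_on with
  | _ n ih =>
    intro t h
    rcases Nat.lt_or_ge n 2 with hn | hn
    · interval_cases n
      · exact ⟨0, rfl, by nlinarith⟩
      · exfalso
        have : t ≤ 2 := by nlinarith
        interval_cases t <;> omega
    · obtain ⟨n', rfl⟩ : ∃ n', n = n' + 2 := ⟨n - 2, by omega⟩
      have h4 : 2 ^ 2 ∣ t * t := ⟨2 ^ n', by rw [h]; ring⟩
      have h2 : 2 ^ 1 ∣ t := by have := ktg_two_pow_dvd_of_sq (a := 2) h4; simpa using this
      obtain ⟨t', rfl⟩ : 2 ∣ t := by simpa using h2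
      have h' : t' * t' = 2 ^ n' := by
        have e : 2 * t' * (2 * t') = 4 * (t' * t') := by ring
        rw [e, pow_add] at h
        omega
      obtain ⟨j, hj, rfl⟩ := ih n' (by omega) t' h'
      exact ⟨j + 1, by omega, by ring⟩

/-! ### The Diophantine system has no solution, for every `k` -/

/-- **No solution, all `k`.**  The system of `ktg_step` has no solution in naturals (uniform closing; the two residual cases `k = 3, 7` go through
`ktg_no_solution`). [this work] -/
theorem ktg_no_solution_all (k w t A B n₁ n₂ : ℕ) (hw : w = 6 * 2 ^ k + t) (ht : 0 < t) (h2 : w < 7 * 2 ^ k)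
    (hdvd : 2 * 2 ^ k ∣ w * w) (hAB : A + B + 1 = 32 * 2 ^ k)
    (hP : A * t ^ 2 + B * (2 * 2 ^ k + t) ^ 2 + w ^ 2 = 32 * 2 ^ k * w) (hn : n₁ + n₂ + 1 = 32 * 2 ^ k)
    (hI : n₁ * (2 * 2 ^ k + t) + n₂ * t + w = w ^ 2)
    (h4 : w ^ 4 + A * t ^ 4 + B * (2 * 2 ^ k + t) ^ 4 = 32 * 2 ^ k * (w ^ 2 + n₁ * (2 * 2 ^ k + t) ^ 2 + n₂ * t ^ 2)) : False := by
  rcases Nat.lt_or_ge k 12 with hk | hk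
  · exact ktg_no_solution k (by omega) w t A B n₁ n₂ hw ht h2 hdvd hAB hP hn hI h4
  -- `k ≥ 12`: the uniform argument (it works from `k ≥ 8` on; smaller `k` are covered above)
  have htt := ktg_t_sq_lt k w t A B hw h2 hAB hP
  set D := 2 * 2 ^ k with hD
  have hDpos : 0 < D := by rw [hD]; positivity
  -- `D ∣ t²`
  have hDt : D ∣ t * t := by
    have h1 : D ∣ w * w := hdvd
    have e : w * w = t * t + D * (18 * 2 ^ k + 6 * t) := by rw [hw, hD]; ring
    rw [e] at h1
    exact (Nat.dvd_add_left (dvd_mul_right _ _)).1 h1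
  obtain ⟨j, hj⟩ := hDt
  have hj1 : 1 ≤ j := by
    rcases Nat.eq_zero_or_pos j with rfl | h
    · rw [mul_zero] at hj
      have : t = 0 := by simpa using hj
      omega
    · exact h
  have hj3 : j ≤ 3 := by
    have h' : D * j < D * 4 := by rw [← hj, hD]; omega
    have := Nat.lt_of_mul_lt_mul_left h'
    omega
  -- Parseval as `B·(D + 2t)·D = D·(39D + 10t) − 16 D t²` (in ℤ), hence `B (D + 2t) + 16 t² = 39 D + 10 t`
  have hPZ : ((B : ℤ) * (D + 2 * t) + 16 * t ^ 2) * D = (39 * D + 10 * t) * D := by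
    have hA : (A : ℤ) = 32 * 2 ^ k - 1 - B := by
      have : ((A + B + 1 : ℕ) : ℤ) = ((32 * 2 ^ k : ℕ) : ℤ) := by rw [hAB]
      push_cast at this; linarith
    have hP' : ((A * t ^ 2 + B * (2 * 2 ^ k + t) ^ 2 + w ^ 2 : ℕ) : ℤ) = ((32 * 2 ^ k * w : ℕ) : ℤ) := by rw [hP]
    push_cast at hP'
    have hw' : (w : ℤ) = 6 * 2 ^ k + t := by exact_mod_cast hw
    have hD' : (D : ℤ) = 2 * 2 ^ k := by exact_mod_cast hD
    rw [hA, hw'] at hP'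
    rw [hD']
    linear_combination hP'
  have hPB : (B : ℤ) * (D + 2 * t) + 16 * t ^ 2 = 39 * D + 10 * t :=
    mul_right_cancel₀ (by exact_mod_cast hDpos.ne') hPZ
  interval_cases j
  · -- `t² = D = 2^{k+1}`: `k` odd, `t = 2^{(k+1)/2}`, and `(t + 2) ∣ 36` — impossible for `t ≥ 64`
    rw [mul_one] at hj
    have hsq : t * t = 2 ^ (k + 1) := by rw [hj, hD]; ring
    obtain ⟨i, hi, hti⟩ := ktg_sq_eq_two_pow (k + 1) t hsq
    have h36 : ((B : ℤ) - 23) * (t + 2) = -36 := by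
      have hDt' : (D : ℤ) = (t : ℤ) ^ 2 := by
        have : ((t * t : ℕ) : ℤ) = ((D * 1 : ℕ) : ℤ) := by rw [← hj, mul_one]
        push_cast at this; linarith
      rw [hDt'] at hPB
      have ht0 : (0 : ℤ) < t := by exact_mod_cast ht
      have key : ((B : ℤ) - 23) * (t + 2) * t = -36 * t := by linear_combination hPB
      exact mul_right_cancel₀ ht0.ne' (by linarith [key])
    -- `t ≥ 64` since `k ≥ 12`: `t² = 2^{k+1} ≥ 2^{13}`
    have ht64 : 64 ≤ t := by
      have hp : 2 ^ 13 ≤ 2 ^ (k + 1) := Nat.pow_le_pow_right (by norm_num) (by omega)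
      by_contra hlt
      push Not at hlt
      have : t * t < 64 * 64 := Nat.mul_lt_mul'' hlt hlt
      omega
    have hdiv : ((t : ℤ) + 2) ∣ 36 := ⟨-((B : ℤ) - 23), by linarith [h36]⟩
    have hle := Int.le_of_dvd (by norm_num) hdiv
    have : (64 : ℤ) ≤ t := by exact_mod_cast ht64
    linarith
  · -- `t² = 2D = 2^{k+2}`: `(t + 4) ∣ 8` — impossible for `t ≥ 4`
    have hsq : t * t = 2 ^ (k + 2) := by rw [hj, hD]; ring
    have h8 : ((B : ℤ) - 7) * (t + 4) = -8 := by
      have hDt' : 2 * (D : ℤ) = (t : ℤ) ^ 2 := by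
        have : ((t * t : ℕ) : ℤ) = ((D * 2 : ℕ) : ℤ) := by rw [← hj]
        push_cast at this; linarith
      have ht0 : (0 : ℤ) < t := by exact_mod_cast ht
      have key : ((B : ℤ) - 7) * (t + 4) * t = -8 * t := by linear_combination 2 * hPB - (B : ℤ) * hDt' + 39 * hDt'
      exact mul_right_cancel₀ ht0.ne' (by linarith [key])
    have ht64 : 64 ≤ t := by
      have hp : 2 ^ 14 ≤ 2 ^ (k + 2) := Nat.pow_le_pow_right (by norm_num) (by omega)
      by_contra hlt
      push Not at hlt
      have : t * t < 64 * 64 := Nat.mul_lt_mul'' hlt hlt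
      omega
    have hdiv : ((t : ℤ) + 4) ∣ 8 := ⟨-((B : ℤ) - 7), by linarith [h8]⟩
    have hle := Int.le_of_dvd (by norm_num) hdiv
    have : (64 : ℤ) ≤ t := by exact_mod_cast ht64
    linarith
  · -- `t² = 3D = 3·2^{k+1}`: not a square
    exact ktg_sq_ne_three_mul_two_pow (k + 1) t (by rw [hj, hD]; ring)

/-! ### The gap for every `m` -/

/-- **The Kasami–Tokura gap of cubics, all `m`.**  For every `m` and every Boolean function `c` of degree `≤ 3` on `m` bits it is NOT the case
that `3·2^m < 16·#{c = 1}` and `32·#{c = 1} < 7·2^m`; i.e. `RM(3,m)` has no weight strictly between `1.5·2^{m-3}` and `1.75·2^{m-3}`.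
NOT summit progress. [this work; cite: KasamiTokura1970 Thm 1] -/
theorem kt_gap_cubic : ∀ (m : ℕ) (c : (Fin m → Bool) → Bool), IsDegLeFun 3 c →
    ¬ (3 * 2 ^ m < 16 * #(univ.filter fun x => c x = true) ∧ 32 * #(univ.filter fun x => c x = true) < 7 * 2 ^ m) := by
  intro m
  induction m with
  | zero => intro c _ h; simp only [pow_zero] at h; omega
  | succ m ihm =>
    intro c hc h
    rcases Nat.lt_or_ge m 4 with hm4 | hm4
    · obtain ⟨h1, h2⟩ := h
      interval_cases m <;> norm_num at h1 h2 <;> omega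
    · obtain ⟨k, rfl⟩ : ∃ k, m = k + 4 := ⟨m - 4, by omega⟩
      have hN : 2 ^ (k + 4 + 1) = 32 * 2 ^ k := by ring
      rw [hN] at h
      have ih' : ∀ c' : (Fin (k + 4) → Bool) → Bool, IsDegLeFun 3 c' →
          ¬ (3 * 2 ^ k < #(univ.filter fun y => c' y = true) ∧ 2 * #(univ.filter fun y => c' y = true) < 7 * 2 ^ k) := by
        intro c' hc' h'
        have hN4 : 2 ^ (k + 4) = 16 * 2 ^ k := by ring
        refine ihm c' hc' ?_
        rw [hN4]; omega
      obtain ⟨w, t, A, B, n₁, n₂, hwS, hwt, hdvd, hAB, hP, hn, hI, h4⟩ :=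
        ktg_step k ih' c hc (by omega) (by omega)
      exact ktg_no_solution_all k w t A B n₁ n₂ hwt (by omega) (by omega) hdvd hAB hP hn hI h4

/-- **The weights of `RM(3,m)` below `1.75 d`**: a Boolean function of degree `≤ 3` on `m` bits with `32·#{c = 1} < 7·2^m` has
`#{c = 1} ∈ {0, 2^{m-3}, 3·2^{m-4}}`, i.e. `w = 0 ∨ 8w = 2^m ∨ 16w = 3·2^m` (second weight `sw_cubic_second_weight` + the gap `kt_gap_cubic`).
NOT summit progress. [this work; cite: KasamiTokura1970 Thm 1] -/
theorem rm3_weights_below_seven_quarters {m : ℕ} (c : (Fin m → Bool) → Bool) (hc : IsDegLeFun 3 c)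
    (h : 32 * #(univ.filter fun x => c x = true) < 7 * 2 ^ m) :
    #(univ.filter fun x => c x = true) = 0 ∨ 8 * #(univ.filter fun x => c x = true) = 2 ^ m ∨
      16 * #(univ.filter fun x => c x = true) = 3 * 2 ^ m := by
  classical
  by_cases h0 : #(univ.filter fun x => c x = true) = 0
  · exact Or.inl h0
  have hne : ∃ x, c x = true := by
    by_contra hn
    push Not at hn
    exact h0 (card_eq_zero.2 (filter_eq_empty_iff.2 fun y _ => hn y))
  by_cases hlt : 16 * #(univ.filter fun x => c x = true) < 3 * 2 ^ m
  · exact Or.inr (Or.inl (sw_cubic_second_weight c hc hne hlt))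
  · have hgap := kt_gap_cubic m c hc
    omega

end Summit.QuantumAdvantage.QuantumAdvantage.Theorems.CubicForrelation.NearExactIsExact

end
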